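import Summits.Ventures.CertifiedManyBodySolver.Observables.StiffnessHalfBathtubBox
import HarnessLib

/-!
# Ventures/CertifiedManyBodySolver — Observables/StiffnessHalfBathtubParticleHole.lean

HONEST FRAMING: one-sided kinematic (one-body, half-bathtub) CEILINGS on the uniform flux stiffness; this file adds the exact
PARTICLE–HOLE IDENTITY of the half-bathtub integral and uses it to transport corner certificates stated on a hole-side box
(`t′ ∈ [t′₁, t′₂]`, `n ≤ n₂`, levels `ν ≥ 0`) to the electron-side IMAGE box (`t′ ∈ [−t′₂, −t′₁]`, `n ≥ 2 − n₂`, levels `ν ≤ 0`)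
with the SAME constant; a ceiling never speaks to the presence of order; not a `T_c` estimate, not a superconductivity verdict; the
Kosterlitz–Thouless reading is CONDITIONAL on the named dictionary.

Cell `hubbard-tc` (MO-S3 ORDER → `T_c` back-end, D-0096), seat p1, `prover-hubbard-tc-p1-g5-0`; companion of `StiffnessHalfBathtubBox`
(§5 there = the `ν ≤ 0` mirror transport with bottom-filling corners). Occasion: S1 box #58 (VSET #29, Sr₂₋ₓLaₓIrO₄ `x = 0.10`) is printed
on the ELECTRON side (`n ∈ [1.09, 1.11]`, `t′/t ∈ [+0.18, +0.33]`) together with its particle–hole image (`n ∈ [0.89, 0.91]`,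
`t′/t ∈ [−0.33, −0.18]`). With `B(t′, ν) = (4π²)⁻¹∫_{−π}^{π}∫_{−π}^{π}(cos x + cos y + 4t′cos x cos y − ν)⁺ dx dy`, PROVED here (pure real
analysis; no definition, no named fact, no computation, no `sorry`):

* `halfBathtubIntegral_particleHole` — **`∫∫(… t′ … − ν)⁺ = ∫∫(… (−t′) … − (−ν))⁺ − 4π²ν`**, i.e. `B(t′, ν) = B(−t′, −ν) − ν`: shift both
  momenta by `π` over a full period (`cos(x + π) = −cos x` flips the two nearest-neighbour symbols and keeps the `t′` product), then
  `(−u)⁺ = u⁺ − u` pointwise and `∫∫(cos x + cos y − 4t′cos x cos y + ν) = 4π²ν`;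
* `halfBathtub_corner_particleHole` — hence a corner value is particle–hole invariant:
  `ν·n/2 + B(t′, ν) ≤ c ⇒ (−ν)·(2 − n)/2 + B(−t′, −ν) ≤ c` (the two sides are EQUAL);
* `ObsThermalStiffnessSeqCeilingAt_imageBox_of_corners_le` / `ObsStiffnessSeqCeilingAt_imageBox_of_corners_le` — **hole-side corner
  certificates at the top filling `n₂` (`ν₁, ν₂ ≥ 0`) ⇒ the thermal / ground-state leaf `c` on the electron-side image box**
  `t′ ∈ [−t′₂, −t′₁]`, `2 − n₂ ≤ n ≤ 2` (corners mapped by `halfBathtub_corner_particleHole`, then §5's `…_of_nonpos` transport);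
* `ThermalKTDictionaryAt.le_pi_div_four_mul_imageBox` — the monotonicity-free KT reading `Tc ≤ (π/4)·c` on the image box.

So ONE pair of kernel rows (the side whose four-corner majorant is tighter — with `ν < 0` the integrand is positive on most of the zone
and the majorant carries more corner slack) certifies BOTH readings of an S1 row. The exact many-body statement behind it — the
`t–t′–U` Hubbard model's flux free energy is invariant under `c ↦ (−1)^{x+y} c†`, `(t′, n) ↦ (−t′, 2 − n)` — is NOT claimed here: the
leaves are reached through the kinematic bound at any real level `ν`, which needs no symmetry of the model.

References: T. Hazra, N. Verma, M. Randeria, PRX 9 (2019) 031049, eqs. (2)–(6) [HazraVermaRanderia2019]; A. Paramekanti, N. Trivedi,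
M. Randeria, PRB 57 (1998) 11639, eq. (3), §IV [ParamekantiTrivediRanderia1998]; W. Rudin, *Principles of Mathematical Analysis*
(1976), Thm 6.12 and Thm 6.19 (linearity; change of variable) [Rudin1976].
-/

noncomputable section

namespace Summit.Ventures.CertifiedManyBodySolver.Observables

open Real MeasureTheory Set Filter Topology
open Literature.MathematicalPhysics.StatisticalMechanics.KosterlitzThouless

/-! ## §1 The particle–hole identity of the half-bathtub integral -/

/-- `(−u)⁺ = u⁺ − u`. [cite: Rudin1976, Thm 6.12] -/
theorem max_neg_zero_eq_max_sub (u : ℝ) : max (-u) 0 = max u 0 - u := by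
  rcases le_total 0 u with h | h
  · rw [max_eq_right (neg_nonpos.mpr h), max_eq_left h]; ring
  · rw [max_eq_left (neg_nonneg.mpr h), max_eq_right h]; ring

/-- Shifting the variable by `π` does not change the integral of a `2π`-periodic function over `[−π, π]`.
[cite: Rudin1976, Thm 6.19] -/
theorem intervalIntegral_comp_add_pi_of_periodic (h : ℝ → ℝ) (hper : Function.Periodic h (2 * π)) :
    (∫ x in (-π)..π, h (x + π)) = ∫ x in (-π)..π, h x := by
  rw [intervalIntegral.integral_comp_add_right]
  have e := hper.intervalIntegral_add_eq (-π + π) (-π)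
  rw [show π + π = -π + π + 2 * π by ring, e, show -π + 2 * π = π by ring]

/-- The half-bathtub integrand after the shift `(x, y) ↦ (x + π, y + π)`: the nearest-neighbour symbols flip, the `t′` product is kept,
so `(cos(x+π) + cos(y+π) + 4t′cos(x+π)cos(y+π) − ν)⁺ = (cos x + cos y + 4(−t′)cos x cos y − (−ν))⁺ − (cos x + cos y + 4(−t′)cos x cos y − (−ν))`.
[cite: HazraVermaRanderia2019, eqs. (2)-(6)] -/
theorem halfBathtubIntegrand_shift_pi (t ν x y : ℝ) :
    max (Real.cos (x + π) + Real.cos (y + π) + 4 * t * (Real.cos (x + π) * Real.cos (y + π)) - ν) 0 =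
      max (Real.cos x + Real.cos y + 4 * (-t) * (Real.cos x * Real.cos y) - (-ν)) 0 -
        (Real.cos x + Real.cos y + 4 * (-t) * (Real.cos x * Real.cos y) - (-ν)) := by
  rw [Real.cos_add_pi, Real.cos_add_pi, ← max_neg_zero_eq_max_sub]
  congr 1
  ring

/-- The integral of the (signed) shifted symbol over the zone: `∫_{−π}^{π}∫_{−π}^{π}(cos x + cos y + 4(−t′)cos x cos y − (−ν)) dx dy = 4π²ν`.
[cite: Rudin1976, Thm 6.12] -/
theorem integral_halfBathtubSymbol (t ν : ℝ) :
    (∫ y in (-π)..π, ∫ x in (-π)..π, (Real.cos x + Real.cos y + 4 * (-t) * (Real.cos x * Real.cos y) - (-ν))) =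
      4 * π ^ 2 * ν := by
  have inner : ∀ y : ℝ, (∫ x in (-π)..π, (Real.cos x + Real.cos y + 4 * (-t) * (Real.cos x * Real.cos y) - (-ν))) =
      2 * π * Real.cos y + 2 * π * ν := by
    intro y
    have e : (fun x : ℝ => Real.cos x + Real.cos y + 4 * (-t) * (Real.cos x * Real.cos y) - (-ν)) =
        fun x : ℝ => (1 + 4 * (-t) * Real.cos y) * Real.cos x + (Real.cos y + ν) := by
      funext x; ring
    rw [e, intervalIntegral.integral_add (Continuous.intervalIntegrable (by fun_prop) _ _)
      (Continuous.intervalIntegrable (by fun_prop) _ _), intervalIntegral.integral_const_mul, integral_cos,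
      intervalIntegral.integral_const]
    simp [Real.sin_neg, Real.sin_pi]
    ring
  simp_rw [inner]
  rw [intervalIntegral.integral_add (Continuous.intervalIntegrable (by fun_prop) _ _)
      (Continuous.intervalIntegrable (by fun_prop) _ _), intervalIntegral.integral_const_mul, integral_cos,
    intervalIntegral.integral_const]
  simp [Real.sin_neg, Real.sin_pi]
  ring

/-- **Particle–hole identity of the half-bathtub integral**:
`∫∫(cos x + cos y + 4t′cos x cos y − ν)⁺ = ∫∫(cos x + cos y + 4(−t′)cos x cos y − (−ν))⁺ − 4π²ν`, i.e. `B(t′, ν) = B(−t′, −ν) − ν` for the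
normalised `B = (4π²)⁻¹∫∫(…)⁺`. [cite: HazraVermaRanderia2019, eqs. (2)-(6)] -/
theorem halfBathtubIntegral_particleHole (t ν : ℝ) :
    (∫ y in (-π)..π, ∫ x in (-π)..π, max (Real.cos x + Real.cos y + 4 * t * (Real.cos x * Real.cos y) - ν) 0) =
      (∫ y in (-π)..π, ∫ x in (-π)..π, max (Real.cos x + Real.cos y + 4 * (-t) * (Real.cos x * Real.cos y) - (-ν)) 0) -
        4 * π ^ 2 * ν := by
  -- the integrands
  set f : ℝ → ℝ → ℝ := fun y x => max (Real.cos x + Real.cos y + 4 * t * (Real.cos x * Real.cos y) - ν) 0 with hfdef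
  set g : ℝ → ℝ → ℝ := fun y x => max (Real.cos x + Real.cos y + 4 * (-t) * (Real.cos x * Real.cos y) - (-ν)) 0 with hgdef
  set G : ℝ → ℝ → ℝ := fun y x => Real.cos x + Real.cos y + 4 * (-t) * (Real.cos x * Real.cos y) - (-ν) with hGdef
  -- periodicity in `x` at fixed `y`, and of the inner integral in `y`
  have hperx : ∀ y : ℝ, Function.Periodic (f y) (2 * π) := by
    intro y x
    simp only [hfdef, Real.cos_add_two_pi]
  have hpery : Function.Periodic (fun y => ∫ x in (-π)..π, f y (x + π)) (2 * π) := by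
    intro y
    simp only [hfdef, Real.cos_add_two_pi]
  -- shift `x`, then `y`
  have step1 : (∫ y in (-π)..π, ∫ x in (-π)..π, f y x) = ∫ y in (-π)..π, ∫ x in (-π)..π, f y (x + π) := by
    refine intervalIntegral.integral_congr fun y _ => ?_
    exact (intervalIntegral_comp_add_pi_of_periodic (f y) (hperx y)).symm
  have step2 : (∫ y in (-π)..π, ∫ x in (-π)..π, f y (x + π)) = ∫ y in (-π)..π, ∫ x in (-π)..π, f (y + π) (x + π) :=
    (intervalIntegral_comp_add_pi_of_periodic (fun y => ∫ x in (-π)..π, f y (x + π)) hpery).symm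
  -- pointwise particle–hole identity under the binders
  have step3 : (∫ y in (-π)..π, ∫ x in (-π)..π, f (y + π) (x + π)) = ∫ y in (-π)..π, ∫ x in (-π)..π, (g y x - G y x) := by
    refine intervalIntegral.integral_congr fun y _ => intervalIntegral.integral_congr fun x _ => ?_
    simp only [hfdef, hgdef, hGdef]
    exact halfBathtubIntegrand_shift_pi t ν x y
  -- linearity
  have hg : Continuous (Function.uncurry g) := continuous_halfBathtubIntegrand _ _
  have hG : Continuous (Function.uncurry G) := by
    rw [hGdef, Function.uncurry_def]; fun_prop
  have hgy : ∀ y, Continuous (g y) := fun y => hg.uncurry_left y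
  have hGy : ∀ y, Continuous (G y) := fun y => hG.uncurry_left y
  have hIg : Continuous fun y => ∫ x in (-π)..π, g y x :=
    intervalIntegral.continuous_parametric_intervalIntegral_of_continuous' hg (-π) π
  have hIG : Continuous fun y => ∫ x in (-π)..π, G y x :=
    intervalIntegral.continuous_parametric_intervalIntegral_of_continuous' hG (-π) π
  have step4 : (∫ y in (-π)..π, ∫ x in (-π)..π, (g y x - G y x)) =
      (∫ y in (-π)..π, ∫ x in (-π)..π, g y x) - ∫ y in (-π)..π, ∫ x in (-π)..π, G y x := by
    have inner : ∀ y, (∫ x in (-π)..π, (g y x - G y x)) = (∫ x in (-π)..π, g y x) - ∫ x in (-π)..π, G y x := fun y =>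
      intervalIntegral.integral_sub ((hgy y).intervalIntegrable _ _) ((hGy y).intervalIntegrable _ _)
    simp_rw [inner]
    exact intervalIntegral.integral_sub (hIg.intervalIntegrable _ _) (hIG.intervalIntegrable _ _)
  have step5 : (∫ y in (-π)..π, ∫ x in (-π)..π, G y x) = 4 * π ^ 2 * ν := by
    simp only [hGdef]
    exact integral_halfBathtubSymbol t ν
  rw [step1, step2, step3, step4, step5]

/-! ## §2 Corner values are particle–hole invariant -/

/-- **A corner value is particle–hole invariant**: `ν·n/2 + B(t′, ν) = (−ν)(2 − n)/2 + B(−t′, −ν)`; in particular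
`ν·n/2 + B(t′, ν) ≤ c ⇒ (−ν)·(2 − n)/2 + B(−t′, −ν) ≤ c`. [cite: HazraVermaRanderia2019, eqs. (2)-(6)] -/
theorem halfBathtub_corner_particleHole {t ν n c : ℝ}
    (h : ν * n / 2 +
      (∫ y in (-π)..π, ∫ x in (-π)..π, max (Real.cos x + Real.cos y + 4 * t * (Real.cos x * Real.cos y) - ν) 0) /
        (4 * π ^ 2) ≤ c) :
    (-ν) * (2 - n) / 2 +
      (∫ y in (-π)..π, ∫ x in (-π)..π, max (Real.cos x + Real.cos y + 4 * (-t) * (Real.cos x * Real.cos y) - (-ν)) 0) /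
        (4 * π ^ 2) ≤ c := by
  have hπ2 : (0 : ℝ) < 4 * π ^ 2 := by positivity
  rw [halfBathtubIntegral_particleHole t ν, sub_div, mul_div_cancel_left₀ ν hπ2.ne'] at h
  linarith

/-! ## §3 Hole-side corner certificates ⇒ the leaves on the electron-side image box -/

/-- **Top-filling corner certificates on `t′ ∈ [t′₁, t′₂]`, `n ≤ n₂` (`ν₁, ν₂ ≥ 0`) ⇒ the THERMAL leaf on the image box**
`t′ ∈ [−t′₂, −t′₁]`, `2 − n₂ ≤ n ≤ 2`, every `U`, with the same constant (corners mapped by `halfBathtub_corner_particleHole`, then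
`ObsThermalStiffnessSeqCeilingAt_box_of_corners_le_of_nonpos`). [cite: ParamekantiTrivediRanderia1998, eq. (3) and §IV] -/
theorem ObsThermalStiffnessSeqCeilingAt_imageBox_of_corners_le {t₁ t₂ ν₁ ν₂ n₂ : ℝ} (hν₁ : 0 ≤ ν₁) (hν₂ : 0 ≤ ν₂)
    (hn₂ : n₂ ≤ 2) (c : ℚ)
    (h₁ : ν₁ * n₂ / 2 +
      (∫ y in (-π)..π, ∫ x in (-π)..π, max (Real.cos x + Real.cos y + 4 * t₁ * (Real.cos x * Real.cos y) - ν₁) 0) /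
        (4 * π ^ 2) ≤ ((c : ℚ) : ℝ))
    (h₂ : ν₂ * n₂ / 2 +
      (∫ y in (-π)..π, ∫ x in (-π)..π, max (Real.cos x + Real.cos y + 4 * t₂ * (Real.cos x * Real.cos y) - ν₂) 0) /
        (4 * π ^ 2) ≤ ((c : ℚ) : ℝ))
    {tp U n : ℝ} (htp : tp ∈ Icc (-t₂) (-t₁)) (hn : 2 - n₂ ≤ n) (hn2 : n ≤ 2) :
    ObsThermalStiffnessSeqCeilingAt tp U n c :=
  ObsThermalStiffnessSeqCeilingAt_box_of_corners_le_of_nonpos (t₁ := -t₂) (t₂ := -t₁) (ν₁ := -ν₂) (ν₂ := -ν₁)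
    (n₁ := 2 - n₂) (neg_nonpos.mpr hν₂) (neg_nonpos.mpr hν₁) (sub_nonneg.mpr hn₂) c
    (halfBathtub_corner_particleHole h₂) (halfBathtub_corner_particleHole h₁) htp hn hn2

/-- The ground-state leaf on the image box from hole-side top-filling corners. [cite: HazraVermaRanderia2019, eqs. (2)-(6)] -/
theorem ObsStiffnessSeqCeilingAt_imageBox_of_corners_le {t₁ t₂ ν₁ ν₂ n₂ : ℝ} (hν₁ : 0 ≤ ν₁) (hν₂ : 0 ≤ ν₂)
    (hn₂ : n₂ ≤ 2) (c : ℚ)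
    (h₁ : ν₁ * n₂ / 2 +
      (∫ y in (-π)..π, ∫ x in (-π)..π, max (Real.cos x + Real.cos y + 4 * t₁ * (Real.cos x * Real.cos y) - ν₁) 0) /
        (4 * π ^ 2) ≤ ((c : ℚ) : ℝ))
    (h₂ : ν₂ * n₂ / 2 +
      (∫ y in (-π)..π, ∫ x in (-π)..π, max (Real.cos x + Real.cos y + 4 * t₂ * (Real.cos x * Real.cos y) - ν₂) 0) /
        (4 * π ^ 2) ≤ ((c : ℚ) : ℝ))
    {tp U n : ℝ} (htp : tp ∈ Icc (-t₂) (-t₁)) (hn : 2 - n₂ ≤ n) (hn2 : n ≤ 2) :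
    ObsStiffnessSeqCeilingAt tp U n c :=
  ObsStiffnessSeqCeilingAt_box_of_corners_le_of_nonpos (t₁ := -t₂) (t₂ := -t₁) (ν₁ := -ν₂) (ν₂ := -ν₁)
    (n₁ := 2 - n₂) (neg_nonpos.mpr hν₂) (neg_nonpos.mpr hν₁) (sub_nonneg.mpr hn₂) c
    (halfBathtub_corner_particleHole h₂) (halfBathtub_corner_particleHole h₁) htp hn hn2

/-! ## §4 The KT reading over the image box -/

/-- **Image-box row grammar, K3-free**: hole-side top-filling corner certificates (`ν₁, ν₂ ≥ 0`, `n₂ ≤ 2`) and the monotonicity-free KT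
dictionary at any anchor of the electron-side image box (`tp ∈ [−t′₂, −t′₁]`, `2 − n₂ ≤ n ≤ 2`) give `Tc ≤ (π/4)·c`.
[cite: HazraVermaRanderia2019, eqs. (2)–(3) and App. G] -/
theorem ThermalKTDictionaryAt.le_pi_div_four_mul_imageBox {t₁ t₂ ν₁ ν₂ n₂ : ℝ} (hν₁ : 0 ≤ ν₁) (hν₂ : 0 ≤ ν₂) (hn₂ : n₂ ≤ 2)
    (c : ℚ)
    (h₁ : ν₁ * n₂ / 2 +
      (∫ y in (-π)..π, ∫ x in (-π)..π, max (Real.cos x + Real.cos y + 4 * t₁ * (Real.cos x * Real.cos y) - ν₁) 0) /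
        (4 * π ^ 2) ≤ ((c : ℚ) : ℝ))
    (h₂ : ν₂ * n₂ / 2 +
      (∫ y in (-π)..π, ∫ x in (-π)..π, max (Real.cos x + Real.cos y + 4 * t₂ * (Real.cos x * Real.cos y) - ν₂) 0) /
        (4 * π ^ 2) ≤ ((c : ℚ) : ℝ))
    {tp U n : ℝ} (htp : tp ∈ Icc (-t₂) (-t₁)) (hn : 2 - n₂ ≤ n) (hn2 : n ≤ 2) {ρe : ℝ → ℝ} {Tc : ℝ}
    (h : ThermalKTDictionaryAt tp U n ρe Tc) : Tc ≤ π / 4 * ((c : ℚ) : ℝ) :=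
  h.le_pi_div_four_mul (ObsThermalStiffnessSeqCeilingAt_imageBox_of_corners_le hν₁ hν₂ hn₂ c h₁ h₂ htp hn hn2)

end Summit.Ventures.CertifiedManyBodySolver.Observables

end
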